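import Summits.Ventures.PercRepro2.CaseOneStarBlockQtZero
import Summits.Ventures.PercRepro2.CaseOneStarEpsQtA
import Summits.Ventures.PercRepro2.CaseOneStarEpsQtB

/-!
# The marked star, Q-threshold form: `iiQt4 ≥ 0`
(blind cell PercRepro2, p1 g16; S5 §2.1 (K9) (q))

`iiQt4 = (1 − q₂) · EredQt` (`iiQt4_factor`), `EredQt` by its `(q₁, q₂)`-Bernstein form (`EredQt_bern`) from the
twelve `epsQt_ij` — nine nonnegative on `[0, 1]²` (`epsQt_ij_nonneg`, CaseOneStarEpsQtA/B.lean), three identically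
zero (`CaseOneStarBlockQtZero.lean`) — so **`iiQt4_nonneg`**. -/

namespace Summit.Ventures.PercRepro2

namespace CaseOne

section MainQt
variable {R : Type*} [Field R] [LinearOrder R] [IsStrictOrderedRing R]

/-- **`iiQt4 ≥ 0`** for weights in `[0, 1]` and cells satisfying the facts. -/
theorem iiQt4_nonneg (q₁ q₂ r s : R) (m : SCells R) (hf : SFacts m)
    (hq₁ : 0 ≤ q₁) (hq₁' : q₁ ≤ 1) (hq₂ : 0 ≤ q₂) (hq₂' : q₂ ≤ 1) (hr : 0 ≤ r) (hr' : r ≤ 1)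
    (hs : 0 ≤ s) (hs' : s ≤ 1) : 0 ≤ iiQt4 q₁ q₂ r s m := by
  have hq₁1 : 0 ≤ 1 - q₁ := sub_nonneg.2 hq₁'
  have hq₂1 : 0 ≤ 1 - q₂ := sub_nonneg.2 hq₂'
  have hepsQt00 : 0 ≤ epsQt00 r s m := epsQt00_nonneg r s m hf hr hr' hs hs'
  have hepsQt01 : 0 ≤ epsQt01 r s m := epsQt01_nonneg r s m hf hr hr' hs hs'
  have hepsQt02 : 0 ≤ epsQt02 r s m := epsQt02_nonneg r s m hf hr hr' hs hs'
  have hepsQt10 : 0 ≤ epsQt10 r s m := epsQt10_nonneg r s m hf hr hr' hs hs'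
  have hepsQt11 : 0 ≤ epsQt11 r s m := epsQt11_nonneg r s m hf hr hr' hs hs'
  have hepsQt12 : 0 ≤ epsQt12 r s m := epsQt12_nonneg r s m hf hr hr' hs hs'
  have hepsQt20 : 0 ≤ epsQt20 r s m := epsQt20_nonneg r s m hf hr hr' hs hs'
  have hepsQt21 : 0 ≤ epsQt21 r s m := epsQt21_nonneg r s m hf hr hr' hs hs'
  have hepsQt22 : 0 ≤ epsQt22 r s m := by
    rw [epsQt22_eq_zero]
  have hepsQt30 : 0 ≤ epsQt30 r s m := epsQt30_nonneg r s m hf hr hr' hs hs'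
  have hepsQt31 : 0 ≤ epsQt31 r s m := by
    rw [epsQt31_eq_zero]
  have hepsQt32 : 0 ≤ epsQt32 r s m := by
    rw [epsQt32_eq_zero]
  have hE : 0 ≤ EredQt q₁ q₂ r s m := by
    have key := EredQt_bern q₁ q₂ r s m
    have w2 : ∀ (c : R) (i j : ℕ), 0 ≤ c →
        0 ≤ c * q₁ ^ i * (1 - q₁) ^ (3 - i) * q₂ ^ j * (1 - q₂) ^ (2 - j) := fun c i j hc =>
      mul_nonneg (mul_nonneg (mul_nonneg (mul_nonneg hc (pow_nonneg hq₁ _)) (pow_nonneg hq₁1 _))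
        (pow_nonneg hq₂ _)) (pow_nonneg hq₂1 _)
    have e00 : 0 ≤ (1 : R) * q₁ ^ 0 * (1 - q₁) ^ 3 * q₂ ^ 0 * (1 - q₂) ^ 2 * epsQt00 r s m :=
      mul_nonneg (w2 1 0 0 (by norm_num)) hepsQt00
    have e01 : 0 ≤ (2 : R) * q₁ ^ 0 * (1 - q₁) ^ 3 * q₂ ^ 1 * (1 - q₂) ^ 1 * epsQt01 r s m :=
      mul_nonneg (w2 2 0 1 (by norm_num)) hepsQt01
    have e02 : 0 ≤ (1 : R) * q₁ ^ 0 * (1 - q₁) ^ 3 * q₂ ^ 2 * (1 - q₂) ^ 0 * epsQt02 r s m :=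
      mul_nonneg (w2 1 0 2 (by norm_num)) hepsQt02
    have e10 : 0 ≤ (3 : R) * q₁ ^ 1 * (1 - q₁) ^ 2 * q₂ ^ 0 * (1 - q₂) ^ 2 * epsQt10 r s m :=
      mul_nonneg (w2 3 1 0 (by norm_num)) hepsQt10
    have e11 : 0 ≤ (6 : R) * q₁ ^ 1 * (1 - q₁) ^ 2 * q₂ ^ 1 * (1 - q₂) ^ 1 * epsQt11 r s m :=
      mul_nonneg (w2 6 1 1 (by norm_num)) hepsQt11
    have e12 : 0 ≤ (3 : R) * q₁ ^ 1 * (1 - q₁) ^ 2 * q₂ ^ 2 * (1 - q₂) ^ 0 * epsQt12 r s m :=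
      mul_nonneg (w2 3 1 2 (by norm_num)) hepsQt12
    have e20 : 0 ≤ (3 : R) * q₁ ^ 2 * (1 - q₁) ^ 1 * q₂ ^ 0 * (1 - q₂) ^ 2 * epsQt20 r s m :=
      mul_nonneg (w2 3 2 0 (by norm_num)) hepsQt20
    have e21 : 0 ≤ (6 : R) * q₁ ^ 2 * (1 - q₁) ^ 1 * q₂ ^ 1 * (1 - q₂) ^ 1 * epsQt21 r s m :=
      mul_nonneg (w2 6 2 1 (by norm_num)) hepsQt21
    have e22 : 0 ≤ (3 : R) * q₁ ^ 2 * (1 - q₁) ^ 1 * q₂ ^ 2 * (1 - q₂) ^ 0 * epsQt22 r s m :=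
      mul_nonneg (w2 3 2 2 (by norm_num)) hepsQt22
    have e30 : 0 ≤ (1 : R) * q₁ ^ 3 * (1 - q₁) ^ 0 * q₂ ^ 0 * (1 - q₂) ^ 2 * epsQt30 r s m :=
      mul_nonneg (w2 1 3 0 (by norm_num)) hepsQt30
    have e31 : 0 ≤ (2 : R) * q₁ ^ 3 * (1 - q₁) ^ 0 * q₂ ^ 1 * (1 - q₂) ^ 1 * epsQt31 r s m :=
      mul_nonneg (w2 2 3 1 (by norm_num)) hepsQt31
    have e32 : 0 ≤ (1 : R) * q₁ ^ 3 * (1 - q₁) ^ 0 * q₂ ^ 2 * (1 - q₂) ^ 0 * epsQt32 r s m :=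
      mul_nonneg (w2 1 3 2 (by norm_num)) hepsQt32
    linarith [key, e00, e01, e02, e10, e11, e12, e20, e21, e22, e30, e31, e32]
  rw [iiQt4_factor]
  exact mul_nonneg hq₂1 hE

end MainQt

end CaseOne

end Summit.Ventures.PercRepro2
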